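import Summits.AtomisticToContinuum.HydrodynamicLimit.Theorems.AntiMazurCoboundariesCorrectorPressureDecayKiferWallLocalLimit
import Literature.MathematicalPhysics.KineticTheory.RegularStationaryState

/-!
# The wall of line `FirstLemma` DECOMPOSED: macro-ergodicity of the infinite hard-sphere flow, stationarity of tangent states,
# and the wall inequality for Gibbs mixtures and for dense states (crux stmt-AtomisticToContinuum-14135
# `AntiMazurCoboundaries.CorrectorPressureDecay` ("X"); lead seat c7, cycle 1)

The registered wall of line `FirstLemma` in local-limit form is `EntropicBoltzmannPropertyWrt IsCanonicalLocalLimitRef`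
(…KiferWallRefClass.lean / …KiferWallLocalLimit.lean): every translation-invariant TANGENT STATE `μ` (vague limit of the
`φ`-weighted blow-ups of an `η_k → 0` almost-stationary family with entropy budget `κ`) pays at least as much specific
relative entropy w.r.t. the canonical local limits as its fast one-body bias per unit volume. This file does NOT prove it;
it ISOLATES ITS OPEN CONTENT into named statements of the board's vocabulary and proves the assembly:

* `HardSphereMacroErgodicity` — THE GIBBS POSTULATE for the infinite hard-sphere dynamics (Dobrushin–Sinai–Sukhov §4.2,
  Bernardin 2014 Def. 1 "macro-ergodic"; the Literature predicate `IsMacroErgodicAt`): below some density `η₀` every regular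
  stationary state of every equilibrium flow is a mixture of Gibbs states. OPEN PROBLEM (typed on the board as the crux
  `Theses.RelEntropyErgodic.GibbsErgodicity`, stmt-AtomisticToContinuum-0779, a variant with explicit flow clauses). Posited.
* `TangentStatesRegularStationary` — the TECHNICAL HALF: there is an equilibrium infinite hard-sphere flow (Alexander 1976)
  for which, at small reduced diameter, every translation-invariant probability tangent state is a REGULAR STATIONARY STATE
  (`RegularStationaryState`: a.e. defined, stationary, finite density and kinetic-energy density, entropy-regular w.r.t. a
  Gibbs state). Content: the flow's existence (Alexander Thm 5.2), the passage of `η_k`-almost-stationarity of the finite-`N`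
  family to stationarity of the local limit under the infinite dynamics (finite speed of influence in the mean, the route's
  `InfluenceLocality` in first-moment form, transferred to the family by the entropy inequality), velocity uniform
  integrability (landed: …TangentBiasVelocityTail), and entropy regularity (the line's `TangentEntropyBoundLocal` plus a
  Gibbs reference). Posited; XL but not open in kind.
* `GibbsMixtureWall` — THE WALL INEQUALITY FOR GIBBS MIXTURES (provable, L): for a translation-invariant mixture
  `μ = ∫ g_(z,β,u) dπ` the bias is `∫ ρ̄(p) m_g(p) dπ` with `m_g(p) = E_{N(u,β⁻¹)}[g((v−u₀)/√θ)]`, the specific relative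
  entropy w.r.t. a canonical local limit `G` (Maxwellian marks `(θ, u₀)` i.i.d. given positions) is affine in `π` and
  `≥ ∫ ρ̄(p) KL(N(u,β⁻¹) ‖ N(u₀,θ)) dπ`, and the Gaussian lemma `sup_(a,r) |E_{N(a,rI)} g| / KL(N(a,rI)‖N(0,I)) ≤ C‖g‖_∞` for
  `g ⊥ 1, v, |v|²` (orthogonality kills the first order; `C` universal) gives the inequality for `‖g‖_∞ ≤ κ₁ := 1/C`.
* `DenseTangentWall` — THE WALL FOR DENSE STATES (provable, L): a translation-invariant law of density `≥ η₀` satisfies the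
  inequality against every canonical local limit at reduced diameter `σ < σd(η₀)` for every `|g| ≤ 1`, because
  `h(μ | G) ≥ ρ log(ρ/ξ(σ)) − ρ + ξ(σ)` (Donsker–Varadhan with `λ N_Λ` and the Ruelle-type exponential-moment bound of window
  counts under canonical local limits, `ξ(σ) = σ³/(1 − v₁σ³) → 0`) dominates `|bias| ≤ ρ`.

`localLimitWall_of_macroErgodicity : TangentStatesRegularStationary → HardSphereMacroErgodicity → GibbsMixtureWall →
DenseTangentWall → EntropicBoltzmannPropertyWrt IsCanonicalLocalLimitRef` (PROVED: dichotomy on the density of the tangent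
state; dilute ones are Gibbs mixtures by macro-ergodicity applied to the regular stationary state supplied by the technical
half). Reading: MODULO THE TECHNICAL HALF AND TWO PROVABLE INEQUALITIES, THE WALL — HENCE THE CRUX X THROUGH THIS LINE — IS
BLOCKED EXACTLY ON THE GIBBS POSTULATE FOR INFINITE HARD SPHERES (board item 0779). The four defs are posited statements of
the line (not literature facts); nothing here is asserted.
-/

noncomputable section

open MeasureTheory ProbabilityTheory Set Filter Topology
open scoped ENNReal

namespace Summit.AtomisticToContinuum.HydrodynamicLimit.Theorems.KiferCompactification

open Literature.MathematicalPhysics.KineticTheory (T3 V3 hsDiameter localGibbsLaw IsMacroErgodicAt RegularStationaryState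
  IsHardSphereGibbsMixture)
open Literature.MathematicalPhysics.KineticTheory.PointProcess (specificRelEntropy density)
open Literature.Analysis.FluidPDE (HardSphereFlow Config InfiniteHardSphereFlow IsHardSphereGibbs IsTranslationInvariant
  windowSumReal)
open Literature.Analysis.FunctionSpaces (PointConfig)

/-! ## The four pieces (posited statements; not claimed) -/

/-- **THE GIBBS POSTULATE (MACRO-ERGODICITY) FOR THE INFINITE HARD-SPHERE DYNAMICS** (posited; OPEN PROBLEM): there is a density
threshold `η₀ > 0` below which every regular stationary state (`RegularStationaryState`: translation invariant, a.e. defined and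
invariant under the flow, finite density and kinetic-energy density, entropy-regular w.r.t. a Gibbs state) of every
EQUILIBRIUM infinite hard-sphere flow of unit diameter in `ℝ³` (`IsEquilibriumFlow`: a.e. defined and stationary for all Gibbs
states — Alexander's flow is one) is a mixture of Gibbs states of the gas (`IsMacroErgodicAt 1 η₀ Φ`;
Dobrushin–Sinai–Sukhov §4.2, Bernardin 2014 Def. 1; board: `Theses.RelEntropyErgodic.GibbsErgodicity`, stmt-AtomisticToContinuum-0779).
Never asserted. -/
def HardSphereMacroErgodicity : Prop :=
  ∃ η₀ : ℝ≥0∞, 0 < η₀ ∧ ∀ Φ : InfiniteHardSphereFlow (Fin 3) 1, Φ.IsEquilibriumFlow → IsMacroErgodicAt 1 η₀ Φ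

/-- **TANGENT STATES ARE REGULAR STATIONARY STATES OF AN EQUILIBRIUM FLOW** (posited; the technical half of the wall): there are a
reduced-diameter threshold `σs > 0` and an equilibrium infinite hard-sphere flow `Φ` of unit diameter in `ℝ³` such that for
`0 < σ < σs`, every activity `a > 0`, temperature `θ > 0`, drift `u₀`, budget `κ > 0` and weight `0 ≤ φ ≤ 1` with `∫φ > 0`, every
translation-invariant probability tangent state of every tangent family is a regular stationary state of `Φ`. Content (none
of it open in kind, all of it XL): existence of Alexander's equilibrium flow; finite speed of influence in the mean for the
finite-`N` dynamics, uniformly under the almost-stationary family, so that its `η_k`-almost-stationarity passes to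
`Φ`-stationarity of the local limit; a.e.-definedness of `Φ` under the limit; finite kinetic-energy density (velocity uniform
integrability, landed); entropy regularity (the line's local-limit entropy bound plus a Gibbs reference). Never asserted. -/
def TangentStatesRegularStationary : Prop :=
  ∃ σs : ℝ, 0 < σs ∧ ∃ Φ : InfiniteHardSphereFlow (Fin 3) 1, Φ.IsEquilibriumFlow ∧
  ∀ (σ a θ : ℝ) (u₀ : V3) (κ : ℝ), 0 < σ → σ < σs → 0 < a → 0 < θ → 0 < κ →
  ∀ (φ : T3 → ℝ), Continuous φ → (∀ x, 0 ≤ φ x) → (∀ x, φ x ≤ 1) → 0 < ∫ x, φ x →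
  ∀ (N : ℕ → ℕ)
    (Φf : ∀ k, HardSphereFlow (Literature.Analysis.FluidPDE.Torus.geometry (Fin 3)) (hsDiameter σ (N k)) (N k + 1))
    (Q : ∀ k, Measure (Config (N k + 1) (Fin 3) T3)),
    IsTangentFamily σ a θ u₀ κ N Φf Q →
    ∀ (ι : ℕ → ℕ) (μ : Measure (PointConfig (V3 × V3))), IsTangentState σ φ N Q ι μ →
      IsProbabilityMeasure μ → IsTranslationInvariant μ → RegularStationaryState Φ μ

/-- **THE WALL INEQUALITY FOR GIBBS MIXTURES** (posited; provable): for every `θ > 0`, `u₀` there is an amplitude `κ₁ > 0` such that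
every translation-invariant probability law `μ` on configurations which is a mixture of Gibbs states of the unit-diameter gas
(`IsHardSphereGibbsMixture 1 μ`) satisfies `ofReal |E_μ[Σ_{p ∈ ω ∩ [0,1)³×ℝ³} g((p.2 − u₀)/√θ)]| ≤ h(μ | G)` for every canonical
local limit `G ∈ IsCanonicalLocalLimitRef σ a θ u₀` and every continuous `g` with `|g| ≤ κ₁`, `g ⊥ 1, v, |v|²`. Mechanism:
componentwise the bias is `ρ̄(p)·E_{N(u,β⁻¹)}[g((·−u₀)/√θ)]`, of second order in the velocity-parameter deviation by the
orthogonality clause and globally `≤ C‖g‖_∞ · KL(N(u,β⁻¹) ‖ N(u₀,θ))`, while `h(g_p | G) ≥ ρ̄(p) KL(N(u,β⁻¹) ‖ N(u₀,θ))` (the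
marks of a canonical local limit are i.i.d. `N(u₀,θ)` given the positions); affinity of `h(· | G)` over the mixture. Never
asserted. -/
def GibbsMixtureWall : Prop :=
  ∀ (θ : ℝ) (u₀ : V3), 0 < θ → ∃ κ₁ : ℝ, 0 < κ₁ ∧
  ∀ (σ a : ℝ), 0 < σ → 0 < a →
  ∀ (G : Measure (PointConfig (V3 × V3))), IsCanonicalLocalLimitRef σ a θ u₀ G →
  ∀ (μ : Measure (PointConfig (V3 × V3))), IsProbabilityMeasure μ → IsTranslationInvariant μ →
    IsHardSphereGibbsMixture 1 μ →
  ∀ (g : V3 → ℝ), Continuous g → (∀ v, |g v| ≤ κ₁) →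
    (∀ (c₀ c₂ : ℝ) (b : V3), ∫ v, g v * (c₀ + inner ℝ b v + c₂ * ‖v‖ ^ 2) ∂(stdGaussian V3) = 0) →
    ENNReal.ofReal |∫ ω, windowSumReal ω (Literature.Analysis.FunctionSpaces.Torus.unitCube (Fin 3))
        (fun p => g ((Real.sqrt θ)⁻¹ • (p.2 - u₀))) ∂μ| ≤ specificRelEntropy μ G

/-- **THE WALL FOR DENSE STATES** (posited; provable): for every density floor `η₀ > 0`, temperature `θ > 0` and drift `u₀` there
is `σd > 0` such that for `0 < σ < σd`, `a > 0`, every canonical local limit `G ∈ IsCanonicalLocalLimitRef σ a θ u₀` and every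
translation-invariant probability law `μ` of density `≥ η₀`, the wall inequality holds for every continuous `|g| ≤ 1`:
`h(μ | G) ≥ ρ log(ρ/ξ(σ)) − ρ + ξ(σ) ≥ ρ ≥ |bias|` once `ρ ≥ e² ξ(σ)`, where `ξ(σ) = σ³/(1 − v₁σ³)` bounds the exponential moments
of window counts under canonical local limits (Ruelle bound, landed for the finite-`N` laws in …KiferCanonicalBlowUpDominationCore)
and the first inequality is Donsker–Varadhan with the test function `λ N_Λ`. Never asserted. -/
def DenseTangentWall : Prop :=
  ∀ (η₀ : ℝ≥0∞), 0 < η₀ → ∀ (θ : ℝ) (u₀ : V3), 0 < θ → ∃ σd : ℝ, 0 < σd ∧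
  ∀ (σ a : ℝ), 0 < σ → σ < σd → 0 < a →
  ∀ (G : Measure (PointConfig (V3 × V3))), IsCanonicalLocalLimitRef σ a θ u₀ G →
  ∀ (μ : Measure (PointConfig (V3 × V3))), IsProbabilityMeasure μ → IsTranslationInvariant μ → η₀ ≤ density μ →
  ∀ (g : V3 → ℝ), Continuous g → (∀ v, |g v| ≤ 1) →
    ENNReal.ofReal |∫ ω, windowSumReal ω (Literature.Analysis.FunctionSpaces.Torus.unitCube (Fin 3))
        (fun p => g ((Real.sqrt θ)⁻¹ • (p.2 - u₀))) ∂μ| ≤ specificRelEntropy μ G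

/-! ## The assembly -/

/-- **THE LOCAL-LIMIT WALL FROM MACRO-ERGODICITY.** Given the technical half (an equilibrium flow `Φ` for which tangent states
at `σ < σs` are regular stationary states), the Gibbs postulate below density `η₀` for every equilibrium flow, the wall
inequality for Gibbs mixtures (amplitude `κ₁`) and for dense states (threshold `σd(η₀)`): take `σw := min σs σd` and
`κ := min κ₁ 1`; a translation-invariant probability tangent state of density `< η₀` is a regular stationary state of `Φ`,
hence a Gibbs mixture, hence satisfies the inequality; one of density `≥ η₀` satisfies it by the dense-state wall. -/
theorem localLimitWall_of_macroErgodicity (hTS : TangentStatesRegularStationary) (hME : HardSphereMacroErgodicity)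
    (hMW : GibbsMixtureWall) (hDW : DenseTangentWall) : EntropicBoltzmannPropertyWrt IsCanonicalLocalLimitRef := by
  intro θ u₀ hθ
  obtain ⟨η₀, hη₀, hME⟩ := hME
  obtain ⟨σs, hσs, Φ, hΦ, hTS⟩ := hTS
  obtain ⟨κ₁, hκ₁, hMW⟩ := hMW θ u₀ hθ
  obtain ⟨σd, hσd, hDW⟩ := hDW η₀ hη₀ θ u₀ hθ
  refine ⟨min σs σd, lt_min hσs hσd, min κ₁ 1, lt_min hκ₁ one_pos, ?_⟩
  intro σ a hσ hσw ha φ hφ hφ0 hφ1 hφi N Φf Q hfam ι μ hμ hμP hμT G hRef g hg hgκ horth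
  have hσs' : σ < σs := hσw.trans_le (min_le_left _ _)
  have hσd' : σ < σd := hσw.trans_le (min_le_right _ _)
  by_cases hdense : η₀ ≤ density μ
  · -- dense tangent states: the density cost alone pays the bias
    exact hDW σ a hσ hσd' ha G hRef μ hμP hμT hdense g hg (fun v => (hgκ v).trans (min_le_right _ _))
  · -- dilute tangent states are regular stationary states, hence Gibbs mixtures
    have hd : density μ < η₀ := not_le.1 hdense
    have hreg : RegularStationaryState Φ μ :=
      hTS σ a θ u₀ (min κ₁ 1) hσ hσs' ha hθ (lt_min hκ₁ one_pos) φ hφ hφ0 hφ1 hφi N Φf Q hfam ι μ hμ hμP hμT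
    have hmix : IsHardSphereGibbsMixture 1 μ := hME Φ hΦ μ hreg hd
    exact hMW σ a hσ ha G hRef μ hμP hμT hmix g hg (fun v => (hgκ v).trans (min_le_left _ _)) horth

end Summit.AtomisticToContinuum.HydrodynamicLimit.Theorems.KiferCompactification

end
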